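import Mathlib.InformationTheory.KullbackLeibler.Basic
import Mathlib.MeasureTheory.Integral.Prod
import Literature.Probability.Divergences.KLDivConvexity

/-!
# Entropy bound for tangent states, VIII: convexity of the relative entropy over a base point, fixed reference (line `FirstLemma`, crux stmt-AtomisticToContinuum-14135)

Helper file of the registered stub `c9_klDiv_map_prod_le_lintegral_const` (lead seat c9, Gibbs route of the
uniform entropy bound), namespace `Summit.AtomisticToContinuum.HydrodynamicLimit.Theorems.KiferCompactification`.

The `x`-averaged blown-up law of the line is a MIXTURE over the base point `x` (law `m`, Haar measure of the torus)
of the blow-ups at `x`: the push-forward `F_* (m ⊗ Q)` of a product law under a jointly measurable map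
`F : T × Z → Ω`, whose components are the laws `P_x := (F(x, ·))_* Q`. The Gibbs route bounds its window entropy
against a FIXED reference law `ρ` by the average of the entropies of the components, i.e. by convexity of
`KL(· ‖ ρ)` under (arbitrary, not necessarily countable) mixtures:

* `c9_klDiv_map_prod_le_lintegral_const` — for probability laws `m`, `Q`, `ρ` and a measurable `F : T × Z → Ω`,
  `KL(F_* (m ⊗ Q) ‖ ρ) ≤ ∫⁻ x, KL((F(x, ·))_* Q ‖ ρ) dm`.

The right-hand side is a lower Lebesgue integral, so no measurability of `x ↦ KL(P_x ‖ ρ)` is claimed or needed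
(`lintegral` is monotone in the integrand, `lintegral_mono`).

Proof (no disintegration, no kernels). If the right-hand side is `∞` there is nothing to prove; otherwise put
`K := (∫⁻ x, KL(P_x ‖ ρ) dm).toReal`. By the Donsker–Varadhan upper bound for bounded measurable test functions
(`Literature.Probability.Divergences.klDiv_le_of_forall_integral_le`) it suffices to show
`∫ ψ d(F_* (m ⊗ Q)) ≤ K + log ∫ e^ψ dρ` for every bounded measurable `ψ : Ω → ℝ`. By Fubini
`∫ ψ d(F_* (m ⊗ Q)) = ∫ (∫ ψ dP_x) dm(x)` (`integral_map_prod_eq_integral_integral_map`); pointwise in `x` the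
log-form Gibbs inequality (`Literature.Probability.Divergences.integral_le_toReal_klDiv_add_log`, when
`KL(P_x ‖ ρ) < ∞`; trivially otherwise) gives `ofReal (∫ ψ dP_x - log ∫ e^ψ dρ) ≤ KL(P_x ‖ ρ)`
(`ofReal_integral_sub_log_integral_exp_le_klDiv`), and integrating in `ℝ≥0∞`,
`ofReal (∫ (∫ ψ dP_x - log ∫ e^ψ dρ) dm) ≤ ∫⁻ ofReal (…) dm ≤ ∫⁻ KL(P_x ‖ ρ) dm = ofReal K`
(`ofReal_integral_le_lintegral_ofReal_of_real`, `lintegral_mono`).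

References: Donsker–Varadhan 1975; Kipnis–Landim 1999, Appendix 1 §8 (entropy is convex); Dupuis–Ellis 1997,
Lemma 1.4.3. No new definitions; general measurable spaces throughout.
-/

noncomputable section

open MeasureTheory ProbabilityTheory Set Filter Topology InformationTheory
open scoped ENNReal NNReal

namespace Summit.AtomisticToContinuum.HydrodynamicLimit.Theorems.KiferCompactification

open Literature.Probability.Divergences (integral_le_toReal_klDiv_add_log klDiv_le_of_forall_integral_le)

/-! ## Measure-theoretic bookkeeping -/

/-- `ofReal (∫ g dμ) ≤ ∫⁻ ofReal (g x) dμ` for every real function `g`: dropping the negative part only increases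
the integral (a non-integrable `g` has Bochner integral `0`). -/
theorem ofReal_integral_le_lintegral_ofReal_of_real {X : Type*} [MeasurableSpace X] (μ : Measure X) (g : X → ℝ) :
    ENNReal.ofReal (∫ x, g x ∂μ) ≤ ∫⁻ x, ENNReal.ofReal (g x) ∂μ := by
  by_cases hg : Integrable g μ
  · rw [integral_eq_lintegral_pos_part_sub_lintegral_neg_part hg]
    exact (ENNReal.ofReal_le_ofReal (sub_le_self _ ENNReal.toReal_nonneg)).trans ENNReal.ofReal_toReal_le
  · rw [integral_undef hg, ENNReal.ofReal_zero]
    exact zero_le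

/-- A measurable function bounded by `C` is integrable under a finite measure. -/
private theorem integrable_of_measurable_of_abs_le {X : Type*} [MeasurableSpace X] (μ : Measure X)
    [IsFiniteMeasure μ] {ψ : X → ℝ} (hψ : Measurable ψ) {C : ℝ} (hC : ∀ x, |ψ x| ≤ C) : Integrable ψ μ :=
  Integrable.of_bound hψ.aestronglyMeasurable C (ae_of_all _ fun x => by rw [Real.norm_eq_abs]; exact hC x)

/-- **Fubini for the push-forward of a product law.** For probability laws `m` on `T` and `Q` on `Z`, a jointly
measurable `F : T × Z → Ω` and a bounded measurable `ψ : Ω → ℝ`, the mean of `ψ` under `F_* (m ⊗ Q)` is the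
`m`-average of its means under the components `(F(x, ·))_* Q`:
`∫ ψ d(F_* (m ⊗ Q)) = ∫ (∫ ψ d((F(x, ·))_* Q)) dm(x)`. -/
theorem integral_map_prod_eq_integral_integral_map {T Z Ω : Type*} [MeasurableSpace T] [MeasurableSpace Z]
    [MeasurableSpace Ω] (m : Measure T) [IsProbabilityMeasure m] (Q : Measure Z) [IsProbabilityMeasure Q]
    {F : T × Z → Ω} (hF : Measurable F) {ψ : Ω → ℝ} (hψ : Measurable ψ) {C : ℝ} (hC : ∀ ω, |ψ ω| ≤ C) :
    ∫ ω, ψ ω ∂((m.prod Q).map F) = ∫ x, ∫ ω, ψ ω ∂(Q.map fun y => F (x, y)) ∂m := by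
  have hi : Integrable (fun p => ψ (F p)) (m.prod Q) :=
    integrable_of_measurable_of_abs_le _ (hψ.comp hF) fun p => hC (F p)
  rw [integral_map hF.aemeasurable hψ.aestronglyMeasurable, integral_prod _ hi]
  refine integral_congr_ae (ae_of_all _ fun x => ?_)
  have hFx : Measurable fun y => F (x, y) := hF.comp measurable_prodMk_left
  show ∫ y, ψ (F (x, y)) ∂Q = ∫ ω, ψ ω ∂(Q.map fun y => F (x, y))
  rw [integral_map hFx.aemeasurable hψ.aestronglyMeasurable]

/-- **Pointwise Gibbs bound in `ℝ≥0∞`.** For probability laws `P`, `ρ` and a bounded measurable `ψ`: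
`ofReal (∫ ψ dP - log ∫ e^ψ dρ) ≤ KL(P ‖ ρ)` — the log-form Gibbs inequality when the divergence is finite,
trivial otherwise. -/
theorem ofReal_integral_sub_log_integral_exp_le_klDiv {Ω : Type*} [MeasurableSpace Ω] (P ρ : Measure Ω)
    [IsProbabilityMeasure P] [IsProbabilityMeasure ρ] {ψ : Ω → ℝ} (hψ : Measurable ψ) {C : ℝ}
    (hC : ∀ ω, |ψ ω| ≤ C) :
    ENNReal.ofReal (∫ ω, ψ ω ∂P - Real.log (∫ ω, Real.exp (ψ ω) ∂ρ)) ≤ klDiv P ρ := by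
  by_cases hfin : klDiv P ρ = ∞
  · rw [hfin]; exact le_top
  rw [← ENNReal.ofReal_toReal hfin]
  exact ENNReal.ofReal_le_ofReal (by linarith [integral_le_toReal_klDiv_add_log hfin hψ hC])

/-! ## Convexity of `KL(· ‖ ρ)` over a base point -/

/-- **Convexity of the relative entropy in the first argument over a base point, fixed reference.** For
probability laws `m` on `T`, `Q` on `Z`, `ρ` on `Ω` and a jointly measurable `F : T × Z → Ω`, the entropy of the
mixture `F_* (m ⊗ Q) = ∫ (F(x, ·))_* Q dm(x)` relative to `ρ` is at most the `m`-average (a lower Lebesgue integral,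
no measurability in `x` needed) of the entropies of its components:
`KL(F_* (m ⊗ Q) ‖ ρ) ≤ ∫⁻ x, KL((F(x, ·))_* Q ‖ ρ) dm`. Proof by the two halves of the Donsker–Varadhan formula and
Fubini, see the module docstring. -/
theorem c9_klDiv_map_prod_le_lintegral_const {T Z Ω : Type*} [MeasurableSpace T] [MeasurableSpace Z]
    [MeasurableSpace Ω] (m : Measure T) [IsProbabilityMeasure m] (Q : Measure Z) [IsProbabilityMeasure Q]
    (ρ : Measure Ω) [IsProbabilityMeasure ρ] {F : T × Z → Ω} (hF : Measurable F) :
    klDiv ((m.prod Q).map F) ρ ≤ ∫⁻ x, klDiv (Q.map fun y => F (x, y)) ρ ∂m := by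
  by_cases htop : ∫⁻ x, klDiv (Q.map fun y => F (x, y)) ρ ∂m = ∞
  · rw [htop]; exact le_top
  haveI : IsProbabilityMeasure ((m.prod Q).map F) := Measure.isProbabilityMeasure_map hF.aemeasurable
  rw [← ENNReal.ofReal_toReal htop]
  refine klDiv_le_of_forall_integral_le fun ψ C hψ hC => ?_
  -- Fubini: the mean of `ψ` under the mixture is the `m`-average of the fibre means `g x := ∫ ψ dP_x`
  rw [integral_map_prod_eq_integral_integral_map m Q hF hψ hC]
  set L : ℝ := Real.log (∫ ω, Real.exp (ψ ω) ∂ρ) with hL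
  set g : T → ℝ := fun x => ∫ ω, ψ ω ∂(Q.map fun y => F (x, y)) with hg
  -- the fibre means are integrable in the base point (bounded and measurable, by Fubini)
  have hgi : Integrable g m := by
    have hi : Integrable (fun p => ψ (F p)) (m.prod Q) :=
      integrable_of_measurable_of_abs_le _ (hψ.comp hF) fun p => hC (F p)
    refine hi.integral_prod_left.congr (ae_of_all _ fun x => ?_)
    have hFx : Measurable fun y => F (x, y) := hF.comp measurable_prodMk_left
    show ∫ y, ψ (F (x, y)) ∂Q = ∫ ω, ψ ω ∂(Q.map fun y => F (x, y))
    rw [integral_map hFx.aemeasurable hψ.aestronglyMeasurable]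
  -- pointwise Gibbs bound `ofReal (g x - L) ≤ KL(P_x ‖ ρ)` (no measurability of the right side is needed below)
  have hpt : ∀ x, ENNReal.ofReal (g x - L) ≤ klDiv (Q.map fun y => F (x, y)) ρ := fun x => by
    have hFx : Measurable fun y => F (x, y) := hF.comp measurable_prodMk_left
    haveI : IsProbabilityMeasure (Q.map fun y => F (x, y)) := Measure.isProbabilityMeasure_map hFx.aemeasurable
    exact ofReal_integral_sub_log_integral_exp_le_klDiv _ ρ hψ hC
  -- integrate the pointwise bound in `ℝ≥0∞`
  have hint : ENNReal.ofReal (∫ x, (g x - L) ∂m) ≤ ∫⁻ x, klDiv (Q.map fun y => F (x, y)) ρ ∂m :=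
    (ofReal_integral_le_lintegral_ofReal_of_real m fun x => g x - L).trans (lintegral_mono hpt)
  rw [ENNReal.ofReal_le_iff_le_toReal htop, integral_sub hgi (integrable_const L), integral_const, smul_eq_mul,
    probReal_univ, one_mul] at hint
  linarith

end Summit.AtomisticToContinuum.HydrodynamicLimit.Theorems.KiferCompactification

end
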